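import Mathlib
import Literature.NumberTheory.Transcendental.KZCalculus
import Literature.NumberTheory.Transcendental.KZLogCalculusProofs
import Literature.NumberTheory.Transcendental.KZDominatedFamilyRelations
import Literature.NumberTheory.Transcendental.KZSemialgebraicComplex
import Literature.NumberTheory.Transcendental.SemialgebraicMapsProofs
import Literature.NumberTheory.Transcendental.EllIterRep
import Summits.KontsevichZagierPeriods.KontsevichZagierPeriods.Theses.TorsionLogs

/-!
# Route TorsionLogs — support item `GKZLevelThreePair`: the T-chain, step (N1b) (folding `x > 1`)
# (`[(0,∞)×(0,1), 3/Y] ∼ [(0,1)², 3(1+x)/Y]`, `Y = √((x³+1)² - 4y²x³)`)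

Helper file for item `stmt-KontsevichZagierPeriods-13812` (`GKZLevelThreePair`), blueprint v3. In the
hyperelliptic chart the 2-dimensional factor `Trep` of the level-3 Euler representation is
`R1 = [(0,∞) × (0,1), 3/Y(x,y)]`, `Y² = x⁶ + 2(1-2y²)x³ + 1 = (x³+1)² - 4y²x³`. The involution
`x ↦ 1/x` of the curve (`Y(1/x) = Y(x)/x³`) folds the half `x > 1` onto `x < 1`:

* `halfline_equivalent_unit` — `[(1,∞)×(0,1), 3/Y] ∼ [(0,1)², 3x/Y]`, ONE change of variables
  `(x,y) ↦ (1/x, y)` (rule 2), Jacobian `1/x²`);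
* `R1_equivalent_R2` — `R1 ∼ R2 = [(0,1)², 3(1+x)/Y]`: split `R1` at the null line `x = 1`
  (rule 1a)), fold, and add the integrands `3/Y + 3x/Y` (rule 1b)).

All representations are PINNED by their domain and their integrand on it; the folded piece is
constructed here (its integrability is transported along the fold).

## References

* M. Kontsevich, D. Zagier, *Periods* (2001), §1.2 rules (1), (2).
-/

-- `Summit.<Summit>.<Sub>` with Sub = Summit (single-conjunct summit, D-0017) duplicates the segment.
set_option linter.dupNamespace false

noncomputable section

namespace Summit.KontsevichZagierPeriods.KontsevichZagierPeriods.Theorems.GKZLevelThree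

open Set MeasureTheory
open MvPolynomial (aeval X C)
open Literature.NumberTheory.Transcendental Literature.NumberTheory.Transcendental.KZ
open Literature.ModelTheory.ExponentialFields (IsSemialgebraic isSemialgebraic_setOf_eval_pos)

/-! ## The fold `(x, y) ↦ (1/x, y)` -/

/-- The matrix of the derivative of the fold at `z`: `diag(-1/z₀², 1)`. -/
theorem hasFDerivAt_fold (z : Fin 2 → ℝ) (hz : z 0 ≠ 0) :
    HasFDerivAt (fun z : Fin 2 → ℝ => (fun i : Fin 2 => if i = 0 then (z 0)⁻¹ else z 1))
      (LinearMap.toContinuousLinearMap (Matrix.toLin' !![-((z 0) ^ 2)⁻¹, 0; 0, 1])) z := by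
  refine hasFDerivAt_pi'.mpr fun i => ?_
  have h0 : HasFDerivAt (fun w : Fin 2 → ℝ => w 0) (ContinuousLinearMap.proj (R := ℝ) (φ := fun _ : Fin 2 => ℝ) 0) z :=
    hasFDerivAt_apply 0 z
  have h1 : HasFDerivAt (fun w : Fin 2 → ℝ => w 1) (ContinuousLinearMap.proj (R := ℝ) (φ := fun _ : Fin 2 => ℝ) 1) z :=
    hasFDerivAt_apply 1 z
  fin_cases i
  · -- the coordinate `(z 0)⁻¹`
    have hinv := (hasFDerivAt_inv hz).comp z h0
    refine (hinv.congr_fderiv ?_).congr_of_eventuallyEq (Filter.Eventually.of_forall fun w => by simp)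
    ext v
    simp [dotProduct, Fin.sum_univ_two]
    ring
  · -- the coordinate `z 1`
    refine (h1.congr_fderiv ?_).congr_of_eventuallyEq (Filter.Eventually.of_forall fun w => by simp)
    ext v
    simp [dotProduct, Fin.sum_univ_two]

/-- The determinant of the derivative of the fold is `-1/z₀²`. -/
theorem det_fold (a : ℝ) :
    (LinearMap.toContinuousLinearMap (Matrix.toLin' !![-(a ^ 2)⁻¹, (0:ℝ); 0, 1])).det = -(a ^ 2)⁻¹ := by
  show LinearMap.det (Matrix.toLin' !![-(a ^ 2)⁻¹, (0:ℝ); 0, 1]) = _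
  rw [LinearMap.det_toLin', Matrix.det_fin_two_of]
  ring

/-- `Y(1/x) = Y(x)/x³`: `((x⁻¹)³+1)² - 4y²(x⁻¹)³ = ((x³+1)² - 4y²x³)/x⁶` (`x ≠ 0`). -/
theorem foldRadicand (x y : ℝ) (hx : x ≠ 0) :
    ((x⁻¹) ^ 3 + 1) ^ 2 - 4 * y ^ 2 * (x⁻¹) ^ 3 = ((x ^ 3 + 1) ^ 2 - 4 * y ^ 2 * x ^ 3) / x ^ 6 := by
  field_simp
  ring

/-- On `(0,1)²` the radicand `(x³+1)² - 4y²x³` is positive (it is `≥ (x³+1)² - 4x³ = (x³-1)²`, and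
`> ` that unless `y = 1`). -/
theorem radicand_pos {x y : ℝ} (hx : 0 < x) (hy0 : 0 ≤ y) (hy1 : y < 1) :
    0 < (x ^ 3 + 1) ^ 2 - 4 * y ^ 2 * x ^ 3 := by
  have hy2 : y ^ 2 < 1 := by nlinarith
  have hx3 : 0 < x ^ 3 := by positivity
  nlinarith [sq_nonneg (x ^ 3 - 1), mul_lt_mul_of_pos_right hy2 hx3]

/-- **The fold** (rule 2)): for `H = [{1 < x, 0 < y < 1}, 3/Y]` and `T = [(0,1)², 3x/Y]` (pinned),
`H ∼ T` by the change of variables `(x,y) ↦ (1/x, y)` from `H.domain` onto `(0,1)²` (injective,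
`ℚ`-semialgebraic, Jacobian `|det| = 1/x²`), with `3/Y(x,y) = (3x′/Y(x′,y)) · (1/x²)` at `x′ = 1/x`
since `Y(1/x) = Y(x)/x³`. [Kontsevich–Zagier 2001, §1.2 rule (2)] -/
theorem halfline_equivalent_unit (H T : IntegralRep 2)
    (hHd : H.domain = {z | 1 < z 0 ∧ (0 < z 1 ∧ z 1 < 1)})
    (hHi : EqOn H.integrand (fun z => 3 / Real.sqrt ((z 0 ^ 3 + 1) ^ 2 - 4 * z 1 ^ 2 * z 0 ^ 3)) H.domain)
    (hTd : T.domain = {z | (0 < z 0 ∧ z 0 < 1) ∧ (0 < z 1 ∧ z 1 < 1)})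
    (hTi : EqOn T.integrand (fun z => 3 * z 0 / Real.sqrt ((z 0 ^ 3 + 1) ^ 2 - 4 * z 1 ^ 2 * z 0 ^ 3)) T.domain) :
    Equivalent H T := by
  set Φ : (Fin 2 → ℝ) → (Fin 2 → ℝ) := fun z => fun i => if i = 0 then (z 0)⁻¹ else z 1 with hΦ
  set Φ' : (Fin 2 → ℝ) → (Fin 2 → ℝ) →L[ℝ] (Fin 2 → ℝ) := fun z =>
    LinearMap.toContinuousLinearMap (Matrix.toLin' !![-((z 0) ^ 2)⁻¹, 0; 0, 1]) with hΦ'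
  have hΦ0 : ∀ z, Φ z 0 = (z 0)⁻¹ := fun z => by simp [hΦ]
  have hΦ1 : ∀ z, Φ z 1 = z 1 := fun z => by simp [hΦ]
  have hdom : ∀ z ∈ H.domain, 1 < z 0 ∧ 0 < z 1 ∧ z 1 < 1 := fun z hz => by
    rw [hHd] at hz; exact ⟨hz.1, hz.2.1, hz.2.2⟩
  -- semialgebraic
  have hsa : IsSemialgebraicMapOn ℚ H.domain Φ := by
    refine IsSemialgebraicMapOn.of_forall H.isSemialgebraic_domain fun j => ?_
    have hX0 : IsSemialgebraicFunOn ℚ H.domain (fun z => z 0) :=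
      (isSemialgebraicFunOn_aeval H.isSemialgebraic_domain (X 0 : MvPolynomial (Fin 2) ℚ)).congr fun z _ => by simp
    have hX1 : IsSemialgebraicFunOn ℚ H.domain (fun z => z 1) :=
      (isSemialgebraicFunOn_aeval H.isSemialgebraic_domain (X 1 : MvPolynomial (Fin 2) ℚ)).congr fun z _ => by simp
    fin_cases j
    · exact (hX0.inv fun z hz => by linarith [(hdom z hz).1]).congr fun z _ => by simp [hΦ0]
    · exact hX1.congr fun z _ => by simp [hΦ1]
  -- derivative
  have hder : ∀ z ∈ H.domain, HasFDerivWithinAt Φ (Φ' z) H.domain z := fun z hz =>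
    (hasFDerivAt_fold z (by linarith [(hdom z hz).1])).hasFDerivWithinAt
  -- injective
  have hinj : InjOn Φ H.domain := by
    intro z hz w hw h
    have h0 := congr_fun h 0
    have h1 := congr_fun h 1
    rw [hΦ0, hΦ0] at h0
    rw [hΦ1, hΦ1] at h1
    ext i
    fin_cases i
    · exact inv_injective h0
    · exact h1
  -- image
  have himage : T.domain = Φ '' H.domain := by
    rw [hTd, hHd]
    ext x
    simp only [mem_setOf_eq, mem_image]
    constructor
    · rintro ⟨⟨hx0, hx1⟩, hy⟩
      refine ⟨fun i => if i = 0 then (x 0)⁻¹ else x 1, ⟨?_, by simpa using hy⟩, ?_⟩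
      · show 1 < (x 0)⁻¹
        exact (one_lt_inv₀ hx0).2 hx1
      · ext i
        fin_cases i
        · simp [hΦ]
        · simp [hΦ]
    · rintro ⟨z, ⟨hz0, hz1⟩, rfl⟩
      refine ⟨⟨by rw [hΦ0]; positivity, ?_⟩, by rw [hΦ1]; exact hz1⟩
      rw [hΦ0]
      exact inv_lt_one_of_one_lt₀ hz0
  -- integrands
  have hint : ∀ z ∈ H.domain, H.integrand z = T.integrand (Φ z) * |(Φ' z).det| := by
    intro z hz
    obtain ⟨hx, hy0, hy1⟩ := hdom z hz
    have hx0 : 0 < z 0 := by linarith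
    have hΦz : Φ z ∈ T.domain := by rw [himage]; exact mem_image_of_mem Φ hz
    rw [hHi hz, hTi hΦz, det_fold, abs_neg, abs_of_pos (by positivity)]
    show 3 / Real.sqrt ((z 0 ^ 3 + 1) ^ 2 - 4 * z 1 ^ 2 * z 0 ^ 3) =
      3 * Φ z 0 / Real.sqrt ((Φ z 0 ^ 3 + 1) ^ 2 - 4 * Φ z 1 ^ 2 * Φ z 0 ^ 3) * (z 0 ^ 2)⁻¹
    rw [hΦ0, hΦ1, foldRadicand (z 0) (z 1) hx0.ne', Real.sqrt_div' _ (by positivity),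
      show Real.sqrt (z 0 ^ 6) = z 0 ^ 3 by
        rw [show z 0 ^ 6 = (z 0 ^ 3) ^ 2 by ring, Real.sqrt_sq (by positivity)]]
    have hrad : 0 < (z 0 ^ 3 + 1) ^ 2 - 4 * z 1 ^ 2 * z 0 ^ 3 := radicand_pos hx0 hy0.le hy1
    have hsq : 0 < Real.sqrt ((z 0 ^ 3 + 1) ^ 2 - 4 * z 1 ^ 2 * z 0 ^ 3) := Real.sqrt_pos.2 hrad
    field_simp
  exact changeOfVariablesRel_subset_relations ⟨2, H, T, Φ, Φ', hsa, hder, hinj, himage, hint, rfl⟩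

/-! ## `R1 = [(0,∞)×(0,1), 3/Y] ∼ R2 = [(0,1)², 3(1+x)/Y]` -/

/-- The folded piece `T = [(0,1)², 3x/Y]` exists as soon as the half `H = [{1<x, 0<y<1}, 3/Y]` does:
its integrand is `ℚ`-semialgebraic and its integrability is that of `H` transported along the fold
(Mathlib's change-of-variables criterion). -/
theorem exists_foldedRep (H : IntegralRep 2) (hHd : H.domain = {z | 1 < z 0 ∧ (0 < z 1 ∧ z 1 < 1)})
    (hHi : EqOn H.integrand (fun z => 3 / Real.sqrt ((z 0 ^ 3 + 1) ^ 2 - 4 * z 1 ^ 2 * z 0 ^ 3)) H.domain) :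
    ∃ T : IntegralRep 2, T.domain = {z | (0 < z 0 ∧ z 0 < 1) ∧ (0 < z 1 ∧ z 1 < 1)} ∧
      T.integrand = fun z => 3 * z 0 / Real.sqrt ((z 0 ^ 3 + 1) ^ 2 - 4 * z 1 ^ 2 * z 0 ^ 3) := by
  set S2 : Set (Fin 2 → ℝ) := {z | (0 < z 0 ∧ z 0 < 1) ∧ (0 < z 1 ∧ z 1 < 1)} with hS2
  set g : (Fin 2 → ℝ) → ℝ := fun z => 3 * z 0 / Real.sqrt ((z 0 ^ 3 + 1) ^ 2 - 4 * z 1 ^ 2 * z 0 ^ 3) with hg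
  have hS2s : IsSemialgebraic ℚ S2 :=
    ((KZ.isSemialgebraic_setOf_const_lt_apply isAlgebraic_zero 0).inter
      (KZ.isSemialgebraic_setOf_apply_lt_const isAlgebraic_one 0)).inter
      ((KZ.isSemialgebraic_setOf_const_lt_apply isAlgebraic_zero 1).inter
      (KZ.isSemialgebraic_setOf_apply_lt_const isAlgebraic_one 1))
  -- semialgebraic integrand
  have hgs : IsSemialgebraicFunOn ℚ S2 g := by
    have hX0 : IsSemialgebraicFunOn ℚ S2 (fun z => 3 * z 0) :=
      (isSemialgebraicFunOn_aeval hS2s (C 3 * X 0 : MvPolynomial (Fin 2) ℚ)).congr fun z _ => by simp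
    have hrad : IsSemialgebraicFunOn ℚ S2 (fun z => (z 0 ^ 3 + 1) ^ 2 - 4 * z 1 ^ 2 * z 0 ^ 3) :=
      (isSemialgebraicFunOn_aeval hS2s ((X 0 ^ 3 + 1) ^ 2 - C 4 * X 1 ^ 2 * X 0 ^ 3 : MvPolynomial (Fin 2) ℚ)).congr
        fun z _ => by simp
    have hsq : IsSemialgebraicFunOn ℚ S2 (fun z => Real.sqrt ((z 0 ^ 3 + 1) ^ 2 - 4 * z 1 ^ 2 * z 0 ^ 3)) :=
      IsSemialgebraicFunOn.sqrt_holds hrad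
    exact (hX0.div hsq fun z hz => (Real.sqrt_pos.2 (radicand_pos hz.1.1 hz.2.1.le hz.2.2)).ne').congr
      fun z _ => rfl
  -- integrability, transported along the fold
  set Φ : (Fin 2 → ℝ) → (Fin 2 → ℝ) := fun z => fun i => if i = 0 then (z 0)⁻¹ else z 1 with hΦ
  set Φ' : (Fin 2 → ℝ) → (Fin 2 → ℝ) →L[ℝ] (Fin 2 → ℝ) := fun z =>
    LinearMap.toContinuousLinearMap (Matrix.toLin' !![-((z 0) ^ 2)⁻¹, 0; 0, 1]) with hΦ'
  have hΦ0 : ∀ z, Φ z 0 = (z 0)⁻¹ := fun z => by simp [hΦ]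
  have hΦ1 : ∀ z, Φ z 1 = z 1 := fun z => by simp [hΦ]
  have hdom : ∀ z ∈ H.domain, 1 < z 0 ∧ 0 < z 1 ∧ z 1 < 1 := fun z hz => by
    rw [hHd] at hz; exact ⟨hz.1, hz.2.1, hz.2.2⟩
  have hmeas : MeasurableSet H.domain := IntegralRep.measurableSet_domain_holds H
  have hder : ∀ z ∈ H.domain, HasFDerivWithinAt Φ (Φ' z) H.domain z := fun z hz =>
    (hasFDerivAt_fold z (by linarith [(hdom z hz).1])).hasFDerivWithinAt
  have hinj : InjOn Φ H.domain := by
    intro z hz w hw h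
    have h0 := congr_fun h 0
    have h1 := congr_fun h 1
    rw [hΦ0, hΦ0] at h0
    rw [hΦ1, hΦ1] at h1
    ext i
    fin_cases i
    · exact inv_injective h0
    · exact h1
  have himage : Φ '' H.domain = S2 := by
    rw [hHd]
    ext x
    simp only [mem_setOf_eq, mem_image, hS2]
    constructor
    · rintro ⟨z, ⟨hz0, hz1⟩, rfl⟩
      refine ⟨⟨by rw [hΦ0]; positivity, ?_⟩, by rw [hΦ1]; exact hz1⟩
      rw [hΦ0]
      exact inv_lt_one_of_one_lt₀ hz0
    · rintro ⟨⟨hx0, hx1⟩, hy⟩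
      refine ⟨fun i => if i = 0 then (x 0)⁻¹ else x 1, ⟨?_, by simpa using hy⟩, ?_⟩
      · show 1 < (x 0)⁻¹
        exact (one_lt_inv₀ hx0).2 hx1
      · ext i
        fin_cases i
        · simp [hΦ]
        · simp [hΦ]
  have hint : IntegrableOn g S2 := by
    rw [← himage, integrableOn_image_iff_integrableOn_abs_det_fderiv_smul volume hmeas hder hinj g]
    refine H.integrableOn.congr_fun (fun z hz => ?_) hmeas
    obtain ⟨hx, hy0, hy1⟩ := hdom z hz
    have hx0 : 0 < z 0 := by linarith
    rw [hHi hz, det_fold, abs_neg, abs_of_pos (by positivity), smul_eq_mul]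
    show 3 / Real.sqrt ((z 0 ^ 3 + 1) ^ 2 - 4 * z 1 ^ 2 * z 0 ^ 3) =
      (z 0 ^ 2)⁻¹ * (3 * Φ z 0 / Real.sqrt ((Φ z 0 ^ 3 + 1) ^ 2 - 4 * Φ z 1 ^ 2 * Φ z 0 ^ 3))
    rw [hΦ0, hΦ1, foldRadicand (z 0) (z 1) hx0.ne', Real.sqrt_div' _ (by positivity),
      show Real.sqrt (z 0 ^ 6) = z 0 ^ 3 by
        rw [show z 0 ^ 6 = (z 0 ^ 3) ^ 2 by ring, Real.sqrt_sq (by positivity)]]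
    have hrad : 0 < (z 0 ^ 3 + 1) ^ 2 - 4 * z 1 ^ 2 * z 0 ^ 3 := radicand_pos hx0 hy0.le hy1
    have hsq : 0 < Real.sqrt ((z 0 ^ 3 + 1) ^ 2 - 4 * z 1 ^ 2 * z 0 ^ 3) := Real.sqrt_pos.2 hrad
    field_simp
  exact ⟨⟨S2, g, hS2s, hgs, hint⟩, rfl, rfl⟩

/-- **Step (N1b)**: `R1 = [(0,∞)×(0,1), 3/Y] ∼ R2 = [(0,1)², 3(1+x)/Y]` (pinned). Split `R1` along the
null line `x = 1` into `[(0,1)², 3/Y]` and `[{1<x}, 3/Y]` (rule 1a)), fold the second onto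
`[(0,1)², 3x/Y]` (`halfline_equivalent_unit`, rule 2)), and add `3/Y + 3x/Y = 3(1+x)/Y` (rule 1b)).
[Kontsevich–Zagier 2001, §1.2 rules (1), (2)] -/
theorem R1_equivalent_R2 (R₁ R₂ : IntegralRep 2)
    (h1d : R₁.domain = {z | 0 < z 0 ∧ (0 < z 1 ∧ z 1 < 1)})
    (h1i : EqOn R₁.integrand (fun z => 3 / Real.sqrt ((z 0 ^ 3 + 1) ^ 2 - 4 * z 1 ^ 2 * z 0 ^ 3)) R₁.domain)
    (h2d : R₂.domain = {z | (0 < z 0 ∧ z 0 < 1) ∧ (0 < z 1 ∧ z 1 < 1)})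
    (h2i : EqOn R₂.integrand (fun z => 3 * (1 + z 0) / Real.sqrt ((z 0 ^ 3 + 1) ^ 2 - 4 * z 1 ^ 2 * z 0 ^ 3))
      R₂.domain) : Equivalent R₁ R₂ := by
  set S2 : Set (Fin 2 → ℝ) := {z | (0 < z 0 ∧ z 0 < 1) ∧ (0 < z 1 ∧ z 1 < 1)} with hS2
  set Sg : Set (Fin 2 → ℝ) := {z | 1 < z 0 ∧ (0 < z 1 ∧ z 1 < 1)} with hSg
  have hS2s : IsSemialgebraic ℚ S2 :=
    ((KZ.isSemialgebraic_setOf_const_lt_apply isAlgebraic_zero 0).inter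
      (KZ.isSemialgebraic_setOf_apply_lt_const isAlgebraic_one 0)).inter
      ((KZ.isSemialgebraic_setOf_const_lt_apply isAlgebraic_zero 1).inter
      (KZ.isSemialgebraic_setOf_apply_lt_const isAlgebraic_one 1))
  have hSgs : IsSemialgebraic ℚ Sg :=
    (KZ.isSemialgebraic_setOf_const_lt_apply isAlgebraic_one 0).inter
      ((KZ.isSemialgebraic_setOf_const_lt_apply isAlgebraic_zero 1).inter
      (KZ.isSemialgebraic_setOf_apply_lt_const isAlgebraic_one 1))
  have h2sub : S2 ⊆ R₁.domain := fun z hz => by rw [h1d]; exact ⟨hz.1.1, hz.2⟩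
  have hgsub : Sg ⊆ R₁.domain := fun z hz => by rw [h1d]; exact ⟨by linarith [hz.1], hz.2⟩
  have husub : S2 ∪ Sg ⊆ R₁.domain := union_subset h2sub hgsub
  set R1a := R₁.restrict S2 hS2s h2sub with hR1a
  set H := R₁.restrict Sg hSgs hgsub with hH
  set U := R₁.restrict (S2 ∪ Sg) (hS2s.union hSgs) husub with hU
  -- (1a) discard the null line `x = 1`
  have hnull : volume (R₁.domain \ (S2 ∪ Sg)) = 0 := by
    have h1 : volume {w : Fin 2 → ℝ | w 0 = 1} = 0 := by
      rw [volume_pi]; exact Measure.pi_hyperplane _ _ _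
    refine measure_mono_null (fun z hz => ?_) h1
    obtain ⟨hz, hnot⟩ := hz
    rw [h1d] at hz
    simp only [mem_union, hS2, hSg, mem_setOf_eq, not_or, not_and] at hnot
    show z 0 = 1
    rcases lt_trichotomy (z 0) 1 with h | h | h
    · exact absurd hz.2.2 (hnot.1 ⟨hz.1, h⟩ hz.2.1)
    · exact h
    · exact absurd hz.2.2 (hnot.2 h hz.2.1)
  have hdrop : of R₁ - of U ∈ relations := R₁.of_sub_of_restrict_mem_relations (hS2s.union hSgs) husub hnull
  have hsplit : of U - of R1a - of H ∈ relations := by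
    refine domainAddRel_subset_relations ⟨2, U, R1a, H, rfl, ?_, fun _ _ => rfl, fun _ _ => rfl, rfl⟩
    have : R1a.domain ∩ H.domain = ∅ := by
      ext z
      simp only [hR1a, hH, IntegralRep.domain_restrict, hS2, hSg, mem_inter_iff, mem_setOf_eq,
        mem_empty_iff_false, iff_false, not_and]
      intro h h' _
      linarith [h.1.2]
    rw [this, measure_empty]
  -- (2) fold the half `x > 1`
  obtain ⟨T, hTd, hTi⟩ := exists_foldedRep H (by rw [hH, IntegralRep.domain_restrict]) (fun z hz => by
    rw [hH, IntegralRep.integrand_restrict, h1i (hgsub hz)])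
  have hfold : Equivalent H T := halfline_equivalent_unit H T (by rw [hH, IntegralRep.domain_restrict])
    (fun z hz => by rw [hH, IntegralRep.integrand_restrict, h1i (hgsub hz)]) hTd (fun z _ => by rw [hTi])
  -- (1b) add the integrands
  have hadd : of R₂ - of R1a - of T ∈ relations := by
    refine integrandAddRel_subset_relations ⟨2, R₂, R1a, T, by rw [hR1a, IntegralRep.domain_restrict, h2d],
      by rw [hTd, h2d], fun z hz => ?_, rfl⟩
    have hz' : z ∈ S2 := by rw [h2d] at hz; exact hz
    rw [h2i hz, Pi.add_apply, hR1a, IntegralRep.integrand_restrict, h1i (h2sub hz'), hTi]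
    ring
  have e : of R₁ - of R₂ = (of R₁ - of U) + (of U - of R1a - of H) + (of H - of T) - (of R₂ - of R1a - of T) := by
    abel
  show of R₁ - of R₂ ∈ relations
  rw [e]
  exact relations.sub_mem (relations.add_mem (relations.add_mem hdrop hsplit) hfold) hadd

end Summit.KontsevichZagierPeriods.KontsevichZagierPeriods.Theorems.GKZLevelThree

end
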